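import Literature.Combinatorics.Optimization.ShellLawGeneratingPolynomial
import HarnessLib

/-!
# Type bounds for shell laws: the hypergeometric variance of a component is of order `N` for
# non-degenerate types, and the three edge types change by at most `c` under stripping a half-set

Companion to `ShellLawGeneratingPolynomial.lean` §6 (lit g32, `sum_abs_nab2_iter_shellLaw_le_threshold`: the
`x`-smoothness number of a shell law is `≤ (2√192·√(4m/V₀))^{2m} + 4^m·(atypical mass)` as soon as every
TYPICAL component `(Y, α)` — a half-set `Y` of size `c` and a number `α` of `HH` edges among the `s` full
edges — has hypergeometric variance `V(b_Y, d_Y, s−α) ≥ V₀`). This file discharges that hypothesis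
DETERMINISTICALLY from the `H`-type `(a, b, d)` (numbers of `HH` / mixed / `H̄H̄` edges) of the ground set:

* §1 **`hypVar_ge`** — `r·b·d·((b+d)−r)/((b+d)²((b+d)−1)) ≥ β⁴·(b+d)` whenever `b, d, r, (b+d)−r ≥ β(b+d)`
  and `b + d ≥ 2` (pure real algebra: the hypergeometric variance is of the order of the population once
  marked/unmarked/drawn/undrawn are all linear fractions).
* §2 type bookkeeping: `card_filter_le_card_filter_add_sdiff`, **`two_mul_reps_le_of_subset`**
  (`2a_S ≤ 2a_{S′} + |S∖S′|`, same for `b`, `d`: deleting `2k` vertices' worth of edges lowers each type by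
  at most `k`), `reps_card_le_of_subset` (types are monotone), **`reps_card_strip_ge`** (`a_Y ≥ a − c`,
  `b_Y ≥ b − c`, `d_Y ≥ d − c` for `Y ∈ halfSets_S(c)`).
* §3 **`hypVar_component_ge`** — THE DISCHARGE: if `β(b+d) + c ≤ min(b, d)`, `β(b+d) ≤ r₀`,
  `s + β(b+d) + 2c ≤ b + d` and `2 ≤ b + d − 2c`, then every component `(Y, α)` with `α + r₀ ≤ s` has
  `V(b_Y, d_Y, s−α) ≥ β⁴·(b + d − 2c)` — the `htyp` hypothesis of `sum_abs_nab2_iter_shellLaw_le_threshold`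
  with `typ Y α := α + r₀ ≤ s` and `V₀ = β⁴(b+d−2c)`.

All PROVED, 0 sorry, no named facts. Cell pnp-psdrank (prover g21, MEMO-24 §2; brick 118 = brick 117 ∘ lit's
threshold lemma ∘ this file ∘ lit's atypical-mass tail).

## References
* [Rothvoss2017] T. Rothvoß, J. ACM 64 (2017), §2 (PDF pp. 5–6): cuts, matchings, the three edge types.
* [RollinRoss2010] A. Röllin, N. Ross, Bernoulli 21 (2015), §4.1 Thm 4.2 (the variance scale of an embedded
  hypergeometric/Bernoulli sum).
-/

noncomputable section

open Finset

namespace Literature.Combinatorics.Optimization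

namespace ShellStep

variable {n : ℕ} {π : Fin n → Fin n}

/-! ### §1 The hypergeometric variance is of order `b + d` for non-degenerate parameters -/

/-- **The hypergeometric variance is of order `b + d` for non-degenerate parameters**: if
`b, d, r, (b+d) − r ≥ β·(b+d)` with `β > 0` and `b + d ≥ 2`, then
`r·b·d·((b+d)−r)/((b+d)²((b+d)−1)) ≥ β⁴·(b+d)`. [cite: RollinRoss2010, §4.1 (Thm 4.2: the variance scale)] -/
theorem hypVar_ge {b d r β : ℝ} (hβ : 0 < β) (h2 : 2 ≤ b + d) (hb : β * (b + d) ≤ b) (hd : β * (b + d) ≤ d)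
    (hr : β * (b + d) ≤ r) (hr' : r + β * (b + d) ≤ b + d) :
    β ^ 4 * (b + d) ≤ r * b * d * (b + d - r) / ((b + d) ^ 2 * (b + d - 1)) := by
  set m := b + d with hm
  have hm0 : 0 < m := by linarith
  have hβm : 0 < β * m := mul_pos hβ hm0
  have hr0 : 0 ≤ r := le_trans hβm.le hr
  have hb0 : 0 ≤ b := le_trans hβm.le hb
  have hm1 : 0 < m - 1 := by linarith
  rw [le_div_iff₀ (mul_pos (pow_pos hm0 2) hm1)]
  have h1 : β * m * (β * m) ≤ r * (m - r) := mul_le_mul hr (by linarith) hβm.le hr0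
  have h2' : β * m * (β * m) ≤ b * d := mul_le_mul hb hd hβm.le hb0
  have h3 : (β * m * (β * m)) * (β * m * (β * m)) ≤ (r * (m - r)) * (b * d) :=
    mul_le_mul h1 h2' (by positivity) (le_trans (by positivity) h1)
  have h4 : m ^ 2 * (m - 1) ≤ m ^ 3 := by nlinarith
  calc β ^ 4 * m * (m ^ 2 * (m - 1)) ≤ β ^ 4 * m * m ^ 3 := by
        exact mul_le_mul_of_nonneg_left h4 (by positivity)
    _ = (β * m * (β * m)) * (β * m * (β * m)) := by ring
    _ ≤ (r * (m - r)) * (b * d) := h3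
    _ = r * b * d * (m - r) := by ring


/-! ### §2 Bookkeeping: the three types under deletion of edges and under stripping a half-set -/

section Types

variable (hπ : ∀ v, π (π v) = v) (hπ' : ∀ v, π v ≠ v)
include hπ hπ'

omit hπ hπ' in
/-- A type class of `S` loses at most `|S ∖ S′|` members when passing to `S′ ⊆ S` (membership in a class
depends only on `v`, `π v` and `H`). [cite: Rothvoss2017, §2 (PDF p. 5)] -/
theorem card_filter_le_card_filter_add_sdiff (S S' : Finset (Fin n)) (p : Fin n → Prop)
    [DecidablePred p] : (S.filter p).card ≤ (S'.filter p).card + (S \ S').card := by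
  calc (S.filter p).card ≤ (S'.filter p ∪ (S \ S')).card := by
        refine card_le_card fun v hv => ?_
        rw [mem_filter] at hv
        rw [mem_union, mem_filter, mem_sdiff]
        by_cases hv' : v ∈ S'
        · exact Or.inl ⟨hv', hv.2⟩
        · exact Or.inr ⟨hv.1, hv'⟩
    _ ≤ (S'.filter p).card + (S \ S').card := card_union_le _ _

/-- **Types under deletion**: for `π`-stable `S′, S` (typically `S′ ⊆ S`), the numbers of `HH`, mixed and `H̄H̄` edges satisfy
`2·a_S ≤ 2·a_{S′} + |S∖S′|`, and likewise for `b` and `d` (each deleted edge lowers exactly one type by one).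
[cite: Rothvoss2017, §2 (PDF p. 5)] -/
theorem two_mul_reps_le_of_subset {S S' : Finset (Fin n)} (hS : ∀ v ∈ S, π v ∈ S) (hS' : ∀ v ∈ S', π v ∈ S')
    (H : Finset (Fin n)) :
    2 * (reps π (vAA π S H)).card ≤ 2 * (reps π (vAA π S' H)).card + (S \ S').card ∧
    2 * (reps π (vBH π S H ∪ vBN π S H)).card ≤ 2 * (reps π (vBH π S' H ∪ vBN π S' H)).card + (S \ S').card ∧
    2 * (reps π (vDD π S H)).card ≤ 2 * (reps π (vDD π S' H)).card + (S \ S').card := by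
  rw [two_mul_card_reps hπ hπ' (vAA_stable hπ S H hS), two_mul_card_reps hπ hπ' (vAA_stable hπ S' H hS'),
    two_mul_card_reps hπ hπ' (vB_stable hπ S H hS), two_mul_card_reps hπ hπ' (vB_stable hπ S' H hS'),
    two_mul_card_reps hπ hπ' (vDD_stable hπ S H hS), two_mul_card_reps hπ hπ' (vDD_stable hπ S' H hS')]
  refine ⟨card_filter_le_card_filter_add_sdiff S S' _, ?_, card_filter_le_card_filter_add_sdiff S S' _⟩
  have e1 : vBH π S H ∪ vBN π S H = S.filter fun v => (v ∈ H ∧ π v ∉ H) ∨ (v ∉ H ∧ π v ∈ H) := by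
    ext v; simp [vBH, vBN, mem_filter, mem_union, and_or_left]
  have e2 : vBH π S' H ∪ vBN π S' H = S'.filter fun v => (v ∈ H ∧ π v ∉ H) ∨ (v ∉ H ∧ π v ∈ H) := by
    ext v; simp [vBH, vBN, mem_filter, mem_union, and_or_left]
  rw [e1, e2]
  exact card_filter_le_card_filter_add_sdiff S S' _

omit hπ hπ' in
/-- Types are monotone: a sub-ground-set has at most as many edges of each type.
[cite: Rothvoss2017, §2 (PDF p. 5)] -/
theorem reps_card_le_of_subset {S S' : Finset (Fin n)} (h : S' ⊆ S) (H : Finset (Fin n)) :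
    (reps π (vAA π S' H)).card ≤ (reps π (vAA π S H)).card ∧
    (reps π (vBH π S' H ∪ vBN π S' H)).card ≤ (reps π (vBH π S H ∪ vBN π S H)).card ∧
    (reps π (vDD π S' H)).card ≤ (reps π (vDD π S H)).card := by
  refine ⟨card_le_card fun v hv => ?_, card_le_card fun v hv => ?_, card_le_card fun v hv => ?_⟩
  · rw [mem_reps, mem_vAA] at hv ⊢; exact ⟨⟨h hv.1.1, hv.1.2⟩, hv.2⟩
  · rw [mem_reps, mem_union, mem_vBH, mem_vBN] at hv ⊢
    rcases hv.1 with h1 | h1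
    · exact ⟨Or.inl ⟨h h1.1, h1.2⟩, hv.2⟩
    · exact ⟨Or.inr ⟨h h1.1, h1.2⟩, hv.2⟩
  · rw [mem_reps, mem_vDD] at hv ⊢; exact ⟨⟨h hv.1.1, hv.1.2⟩, hv.2⟩

/-- **Types under stripping a half-set**: for `Y ∈ halfSets_S(c)` the stripped ground set `S ∖ (Y ∪ πY)` has
`a_Y ≥ a − c`, `b_Y ≥ b − c`, `d_Y ≥ d − c` (and `a_Y ≤ a`, `b_Y ≤ b`, `d_Y ≤ d` by `reps_card_le_of_subset`).
[cite: Rothvoss2017, §2 (PDF p. 5)] -/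
theorem reps_card_strip_ge {S Y : Finset (Fin n)} (hS : ∀ v ∈ S, π v ∈ S) (H : Finset (Fin n)) {c : ℕ}
    (hY : Y ∈ halfSets π S c) :
    (reps π (vAA π S H)).card ≤ (reps π (vAA π (strip π S Y) H)).card + c ∧
    (reps π (vBH π S H ∪ vBN π S H)).card ≤ (reps π (vBH π (strip π S Y) H ∪ vBN π (strip π S Y) H)).card + c ∧
    (reps π (vDD π S H)).card ≤ (reps π (vDD π (strip π S Y) H)).card + c := by
  have hsub : strip π S Y ⊆ S := sdiff_subset
  have hcard : (S \ strip π S Y).card = 2 * c := by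
    rw [card_sdiff, inter_eq_left.2 hsub]
    have := card_strip hπ hS hY
    omega
  have h := two_mul_reps_le_of_subset hπ hπ' (S' := strip π S Y) hS (strip_stable (Y := Y) hπ hS) H
  rw [hcard] at h
  omega

end Types

/-! ### §3 The discharge of the typical-component variance hypothesis from the type of the ground set -/

section Discharge

variable (hπ : ∀ v, π (π v) = v) (hπ' : ∀ v, π v ≠ v)
include hπ hπ'

/-- **Typical components have variance `≥ β⁴(b+d−2c)`.** Let `S` be `π`-stable with `b` mixed and `d` `H̄H̄`
edges (as `reps` counts), `c` the level, `s` the number of full edges, `r₀` a threshold and `β > 0`. If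
`β(b+d) + c ≤ b`, `β(b+d) + c ≤ d`, `β(b+d) ≤ r₀`, `s + β(b+d) + 2c ≤ b + d` and `2 ≤ b + d − 2c`, then for every
half-set `Y ∈ halfSets_S(c)` and every `α ≤ s` with `α + r₀ ≤ s` the component `(Y, α)` has hypergeometric variance
`(s−α)·b_Y·d_Y·((b_Y+d_Y)−(s−α))/((b_Y+d_Y)²((b_Y+d_Y)−1)) ≥ β⁴·(b+d−2c)`.
[cite: Rothvoss2017, §2 (PDF p. 6)] [cite: RollinRoss2010, §4.1 Thm 4.2] -/
theorem hypVar_component_ge {S : Finset (Fin n)} (hS : ∀ v ∈ S, π v ∈ S) (H : Finset (Fin n)) (c s r₀ : ℕ)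
    {β : ℝ} (hβ : 0 < β)
    (hb : β * (((reps π (vBH π S H ∪ vBN π S H)).card : ℝ) + (reps π (vDD π S H)).card) + c ≤
      (reps π (vBH π S H ∪ vBN π S H)).card)
    (hd : β * (((reps π (vBH π S H ∪ vBN π S H)).card : ℝ) + (reps π (vDD π S H)).card) + c ≤
      (reps π (vDD π S H)).card)
    (hr₀ : β * (((reps π (vBH π S H ∪ vBN π S H)).card : ℝ) + (reps π (vDD π S H)).card) ≤ r₀)
    (hs : (s : ℝ) + β * (((reps π (vBH π S H ∪ vBN π S H)).card : ℝ) + (reps π (vDD π S H)).card) + 2 * c ≤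
      ((reps π (vBH π S H ∪ vBN π S H)).card : ℝ) + (reps π (vDD π S H)).card)
    (h2 : 2 + 2 * c ≤ (reps π (vBH π S H ∪ vBN π S H)).card + (reps π (vDD π S H)).card) :
    ∀ Y ∈ halfSets π S c, ∀ α ∈ range (s + 1), α + r₀ ≤ s →
      β ^ 4 * ((((reps π (vBH π S H ∪ vBN π S H)).card : ℝ) + (reps π (vDD π S H)).card) - 2 * c) ≤
        ((s - α : ℕ) : ℝ) * (reps π (vBH π (strip π S Y) H ∪ vBN π (strip π S Y) H)).card *
          (reps π (vDD π (strip π S Y) H)).card *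
          (((reps π (vBH π (strip π S Y) H ∪ vBN π (strip π S Y) H)).card : ℝ) +
            (reps π (vDD π (strip π S Y) H)).card - ((s - α : ℕ) : ℝ)) /
        ((((reps π (vBH π (strip π S Y) H ∪ vBN π (strip π S Y) H)).card : ℝ) +
            (reps π (vDD π (strip π S Y) H)).card) ^ 2 *
          (((reps π (vBH π (strip π S Y) H ∪ vBN π (strip π S Y) H)).card : ℝ) +
            (reps π (vDD π (strip π S Y) H)).card - 1)) := by
  intro Y hY α hα hαr
  set b := (reps π (vBH π S H ∪ vBN π S H)).card with hbdef
  set d := (reps π (vDD π S H)).card with hddef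
  set bY := (reps π (vBH π (strip π S Y) H ∪ vBN π (strip π S Y) H)).card with hbYdef
  set dY := (reps π (vDD π (strip π S Y) H)).card with hdYdef
  have hαs : α ≤ s := Nat.lt_succ_iff.1 (mem_range.1 hα)
  -- bookkeeping: `b − c ≤ bY ≤ b`, `d − c ≤ dY ≤ d`
  obtain ⟨_, hbge, hdge⟩ := reps_card_strip_ge hπ hπ' hS H hY
  obtain ⟨_, hble, hdle⟩ := reps_card_le_of_subset (π := π) (S := S) (S' := strip π S Y) (by exact sdiff_subset) H
  rw [← hbdef, ← hbYdef] at hbge hble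
  rw [← hddef, ← hdYdef] at hdge hdle
  have hbge' : (b : ℝ) ≤ (bY : ℝ) + c := by exact_mod_cast hbge
  have hdge' : (d : ℝ) ≤ (dY : ℝ) + c := by exact_mod_cast hdge
  have hble' : (bY : ℝ) ≤ b := by exact_mod_cast hble
  have hdle' : (dY : ℝ) ≤ d := by exact_mod_cast hdle
  have hr : ((s - α : ℕ) : ℝ) = (s : ℝ) - α := by push_cast [Nat.cast_sub hαs]; ring
  have hαr' : (α : ℝ) + r₀ ≤ s := by exact_mod_cast hαr
  have h2' : (2 : ℝ) + 2 * c ≤ (b : ℝ) + d := by exact_mod_cast h2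
  -- the β-margins for the component, with `m_Y = bY + dY ≥ b + d − 2c`
  have hβm : β * ((bY : ℝ) + dY) ≤ β * ((b : ℝ) + d) :=
    mul_le_mul_of_nonneg_left (by linarith) hβ.le
  have key := hypVar_ge (b := (bY : ℝ)) (d := (dY : ℝ)) (r := ((s - α : ℕ) : ℝ)) hβ (by linarith)
    (by linarith) (by linarith) (by rw [hr]; linarith) (by rw [hr]; linarith)
  refine le_trans ?_ key
  have hβ4 : 0 ≤ β ^ 4 := by positivity
  nlinarith

end Discharge

end ShellStep

end Literature.Combinatorics.Optimization

end
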